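import Summits.ABC.ABC.Theses.DefiniteXi
import Summits.ABC.ABC.Theorems.DefiniteXiDefiniteRTControlPrime
import Summits.ABC.ABC.Theorems.DefiniteXiFreyModularity
import Summits.ABC.ABC.Theorems.DefiniteXiDefiniteRTControlPrimeSmulTransportDeg
import Summits.ABC.ABC.Theorems.DefiniteXiDefiniteRTControlPrimeValTransport
import Summits.ABC.ABC.Theorems.DefiniteXiDefiniteRTControlPrimeFreyScale
import Summits.ABC.ABC.Theorems.DefiniteXiDefiniteRTControlPrimeFreyLocal
import Summits.ABC.ABC.Theorems.IsogenyGlueCongruenceMazurKenkuBoundOfRadius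
import Literature.NumberTheory.EllipticCurves.TakahashiDegreeFormulaCoprimeProofs
import Literature.NumberTheory.EllipticCurves.PastenSpectralDegree
import Literature.NumberTheory.EllipticCurves.PastenHeightBounds
import Literature.NumberTheory.EllipticCurves.PastenHeightBoundsLemma68LocalProofs
import Literature.NumberTheory.EllipticCurves.PastenSpectralDegreeIsogenyBoundProofs
import Literature.NumberTheory.EllipticCurves.IsogenyDegreeLatticeIndexProofs
import Literature.NumberTheory.EllipticCurves.ModularCurveManinSemistableBridgeProofs
import Literature.NumberTheory.EllipticCurves.ModularDegreeMinimal
import Literature.NumberTheory.EllipticCurves.IsogenyVariableChangeProofs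
import Literature.NumberTheory.EllipticCurves.IsogenyCompProofs
import Literature.NumberTheory.EllipticCurves.IsogenyDualProofs
import Literature.NumberTheory.EllipticCurves.IsogenyIdProofs
import Literature.NumberTheory.EllipticCurves.RationalIsogenyDegreesProofs
import Literature.NumberTheory.Automorphic.ShimuraCurveRibetTakahashiComponentOrders
import Literature.NumberTheory.DiophantineGeometry.MinimalDiscriminantFactorizationProofs
import HarnessLib

/-!
# Stub ideas k2 (gen 6, family RESHAPE) — `stub_pastenLemma68 : PastenShimura2024_lemma_6_8`
(crux `DefiniteRTControlPrime`, stmt-ABC-11338, route `DefiniteXi`, skeleton `Lines/Sketch.lean`).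

**Gen-6 reshape: the WEIGHTED (one-product) leaf = the necessity floor, typed and glued.**
Gen 5 (`StubIdeasK2G5PastenLemma68.lean`, this directory) re-rooted both Pasten legs on ONE isogeny
`φ : E_(a,b) → W⋆` to the Takahashi pivot and typed the leaf as a RADIUS (`deg φ ≤ R N^ε`, cost
`4 R²`).  But the pivot proof charges `φ` only through the PRODUCT

  `Q(φ) := deg φ · v_q(Δ_min W⋆) / v_q(Δ_min E)`

(`deg D_min(E) ≤ 4 · deg φ · deg P⋆ ≤ 4 · deg φ · ξ · v_q(Δ_min W⋆) = 4 · Q(φ) · ξ · v_q(Δ_min E)`),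
and by the Tate-curve bookkeeping of a cyclic isogeny at a multiplicative place
(`exists_ordMinimalDiscriminant_mul_eq_mul_of_isCyclic`: `deg φ = a·b·r`, `v(E)·b = v(W⋆)·a`)

  `Q(φ) = b² · r`       (X below: `b` = the `q`-TORIC index of `ker φ`, `r` the cofactor),

so the valuation-RAISING part `a` of the isogeny is FREE and only the toric index is charged —
the verbatim `163` of Lemma 6.8 (a bound on `max(a,b)`) and the radius (a bound on `a·b·r`) both
over-pay.  This file types the weakest sufficient leaf **W0** `FreyWeightedTransportSubpoly`
(`∃ φ, deg φ · v_q(Δ_min W⋆) ≤ R_ε N^ε · v_q(Δ_min E)`), proves the glue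
`definiteRTControlPrime_of_weightedTransportSubpoly` (`C(ε) = 4 (R_ε + 1)`, NO valuation leg, no
`h68`, no `h163`, no `W₀`), the exact-cost lemma X, and the feeders radius ⟹ W0 (so every earlier
supplier — stmt-ABC-15193, the k2-g3 `Cor 4.4 + KF13 + Frey-5` radius, the Mazur-free polylog
programmes of k1-68 / k2-163 — still applies, with its constant squared exactly once).

Sections 1–2 (P1a, congr′, P1, R0a, R0c, H2a, H2) are reproduced VERBATIM from gen 5 (k2), because
`Cruxes/…` modules are not built on the farm and cannot be imported; they were `lean check` rc 0 there.
The verbatim stub is not touched (verdict unchanged: `blocked-on stmt-ABC-15193`).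
-/

set_option linter.dupNamespace false

noncomputable section

open scoped Classical MatrixGroups ModularForm
open CongruenceSubgroup UpperHalfPlane
open WeierstrassCurve IsDedekindDomain NumberField
open Literature.NumberTheory.EllipticCurves Literature.NumberTheory.EllipticCurves.ModularForms
open Literature.NumberTheory.DiophantineGeometry
open Literature.NumberTheory.Automorphic
open Summit.ABC.ABC.Theorems
open Summit.ABC.ABC.Theses.DefiniteXi

namespace Summit.ABC.ABC.Cruxes.DefiniteRTControlPrime.StubIdeas2G6

/-! ## 0. The leaves -/

/-- **L1** (k2-g2…g5, verbatim): rooted radius of the Frey isogeny class at an odd conductor prime. -/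
def FreyIsogenyRadius (R : ℕ) : Prop :=
  ∀ (a b : ℤ), IsCoprime a b → a * b * (a + b) ≠ 0 → ∀ q : ℕ, q.Prime → q ≠ 2 →
    q ∣ (freyCurve a b).conductorNorm ℤ →
    ∀ (W' : WeierstrassCurve ℚ) [W'.IsElliptic], (freyCurve a b).IsIsogenous W' →
      ∃ φ : Isogeny (freyCurve a b) W', φ.degree ≤ R

/-- **L0** (k2-g5, verbatim): the Frey curve of conductor `N` is `R_ε N^ε`-close to any
`X₀(N)`-optimal curve `W⋆` of its class (Takahashi's minimality clause). -/
def FreyOptimalRadiusSubpoly : Prop :=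
  ∀ ε : ℝ, 0 < ε → ∃ R : ℝ, ∀ (a b : ℤ), IsCoprime a b → a * b * (a + b) ≠ 0 →
    ∀ (N : ℕ) [NeZero N], (freyCurve a b).conductorNorm ℤ = N →
    ∀ q : ℕ, q.Prime → q ≠ 2 → q ∣ N →
    ∀ (W' : WeierstrassCurve ℚ) [W'.IsElliptic] (P' : ModularParametrizationData W' N),
      W'.conductorNorm ℤ = N →
      (∀ (W'' : WeierstrassCurve ℚ) [W''.IsElliptic], W''.conductorNorm ℤ = N →
          ∀ P'' : ModularParametrizationData W'' N, P''.f = P'.f →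
            P'.modularDegree ≤ P''.modularDegree) →
      (freyCurve a b).IsIsogenous W' →
        ∃ φ : Isogeny (freyCurve a b) W', (φ.degree : ℝ) ≤ R * (N : ℝ) ^ ε

/-- **W0 — THE WEIGHTED LEAF (gen 6; the necessity floor of the pivot proof).**  For every `ε > 0`
there is `R` such that for all coprime `a, b`, `N` the conductor, `q` an odd prime of `N`, and any
`X₀(N)`-optimal curve `W⋆` of the class (conductor `N`, datum `P⋆` minimal among level-`N` data of
conductor-`N` curves with the same newform — verbatim Takahashi's clause), SOME `ℚ`-isogeny
`φ : E_(a,b) → W⋆` has `deg φ · v_q(Δ_min W⋆) ≤ R · N^ε · v_q(Δ_min E_(a,b))`.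
By X below the left side is `b(φ)² r(φ) · v_q(Δ_min E)`: only the `q`-toric index of `ker φ` is charged. -/
def FreyWeightedTransportSubpoly : Prop :=
  ∀ ε : ℝ, 0 < ε → ∃ R : ℝ, ∀ (a b : ℤ), IsCoprime a b → a * b * (a + b) ≠ 0 →
    ∀ (N : ℕ) [NeZero N], (freyCurve a b).conductorNorm ℤ = N →
    ∀ q : ℕ, q.Prime → q ≠ 2 → q ∣ N →
    ∀ (W' : WeierstrassCurve ℚ) [W'.IsElliptic] (P' : ModularParametrizationData W' N),
      W'.conductorNorm ℤ = N →
      (∀ (W'' : WeierstrassCurve ℚ) [W''.IsElliptic], W''.conductorNorm ℤ = N →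
          ∀ P'' : ModularParametrizationData W'' N, P''.f = P'.f →
            P'.modularDegree ≤ P''.modularDegree) →
      (freyCurve a b).IsIsogenous W' →
        ∃ φ : Isogeny (freyCurve a b) W',
          (φ.degree : ℝ) * ((W'.minimalDiscriminantNorm ℤ).factorization q : ℝ) ≤
            R * (N : ℝ) ^ ε * (((freyCurve a b).minimalDiscriminantNorm ℤ).factorization q : ℝ)

/-! ## 1. Plumbing (verbatim from gen 5): composites, duals, kernels of `z ↦ cz` -/

/-- R0a (PROVED, gen 4/5 verbatim): degree of a composite. [folklore] -/
theorem degree_comp {W W' W'' : WeierstrassCurve ℚ} [W.IsElliptic] [W'.IsElliptic]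
    (ψ : Isogeny W' W'') (φ : Isogeny W W') : (ψ.comp φ).degree = ψ.degree * φ.degree := by
  change Nat.card (ψ.toAddMonoidHom.comp φ.toAddMonoidHom).ker = _
  rw [AddMonoidHom.natCard_ker_comp_of_surjective _ _ φ.surjective]
  rfl

/-- R0c (gen 5 verbatim): the dual isogeny has the same degree.
[cite: SilvermanAEC2009, Thm. III.6.1(a), III.6.2(e)] -/
theorem exists_dual_degree_eq {W W' : WeierstrassCurve ℚ} [W.IsElliptic] [W'.IsElliptic]
    (φ : Isogeny W W') : ∃ ψ : Isogeny W' W, ψ.degree = φ.degree := by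
  obtain ⟨ψ, hψ⟩ := φ.exists_dual_of_isElliptic
  exact ⟨ψ, Isogeny_degree_eq_of_comp_eq_degree_zsmul φ ψ hψ⟩

/-- **P1a** (gen 5 verbatim). Kernels multiply along `ℂ/Λ₁ →(c) ℂ/Λ₂ →(d) ℂ/Λ₃`. [folklore] -/
theorem natCard_ker_mulQuotientMap_mul {Λ₁ Λ₂ Λ₃ : AddSubgroup ℂ} {c d : ℂ} (hc0 : c ≠ 0)
    (hc : ∀ z ∈ Λ₁, c * z ∈ Λ₂) (hd : ∀ z ∈ Λ₂, d * z ∈ Λ₃)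
    (hdc : ∀ z ∈ Λ₁, d * c * z ∈ Λ₃) :
    Nat.card (mulQuotientMap Λ₁ Λ₃ (d * c) hdc).ker =
      Nat.card (mulQuotientMap Λ₂ Λ₃ d hd).ker * Nat.card (mulQuotientMap Λ₁ Λ₂ c hc).ker := by
  have hcomp : (mulQuotientMap Λ₂ Λ₃ d hd).comp (mulQuotientMap Λ₁ Λ₂ c hc) =
      mulQuotientMap Λ₁ Λ₃ (d * c) hdc := by
    refine AddMonoidHom.ext fun P => ?_
    induction P using QuotientAddGroup.induction_on with
    | H z =>
      rw [AddMonoidHom.comp_apply, mulQuotientMap_mk, mulQuotientMap_mk, mulQuotientMap_mk,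
        mul_assoc]
  rw [← hcomp, AddMonoidHom.natCard_ker_comp_of_surjective _ _ (mulQuotientMap_surjective hc0)]

/-- Transport of `#ker(z ↦ cz)` along equalities of the lattices AND of the multiplier (gen 5
verbatim). [folklore] -/
theorem natCard_ker_mulQuotientMap_congr' {Λ₁ Λ₁' Λ₂ Λ₂' : AddSubgroup ℂ} (h₁ : Λ₁ = Λ₁')
    (h₂ : Λ₂ = Λ₂') {c c' : ℂ} (hcc : c = c') (hc : ∀ z ∈ Λ₁, c * z ∈ Λ₂)
    (hc' : ∀ z ∈ Λ₁', c' * z ∈ Λ₂') :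
    Nat.card (mulQuotientMap Λ₁ Λ₂ c hc).ker = Nat.card (mulQuotientMap Λ₁' Λ₂' c' hc').ker := by
  subst h₁ h₂ hcc
  rfl

/-! ## 2. P1 (gen 5 verbatim) — push a datum forward along ONE isogeny, keeping the degree -/

/-- **P1** (gen 5 verbatim).  `deg D'_min ≤ deg ψ · deg P` for an isogeny `ψ` from (the lattice
curve of) a parametrised `(V, P)` onto (the lattice curve of) a globally minimal `(W', D')` with the
same newform.  [cite: SilvermanAEC2009, Thm. VI.4.1(b)] [cite: EdixhovenManin1991, Prop. 2] -/
theorem modularDegree_le_degree_mul {N : ℕ} [NeZero N] {V W' : WeierstrassCurve ℚ}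
    [V.IsElliptic] [W'.IsElliptic] [W'.IsGloballyMinimal]
    (P : ModularParametrizationData V N) (D' : ModularParametrizationData W' N) (hf : D'.f = P.f)
    (hmin' : ∀ D'' : ModularParametrizationData W' N, D'.modularDegree ≤ D''.modularDegree)
    {Vs Ws : WeierstrassCurve ℚ} [Vs.IsElliptic] [Ws.IsElliptic] (ψ : Isogeny Vs Ws)
    (hVs : Vs.baseChange ℂ = P.L.curve) (hWs : Ws.baseChange ℂ = D'.L.curve) :
    D'.modularDegree ≤ ψ.degree * P.modularDegree := by
  have hInt : ∀ {N : ℕ} [NeZero N] {W' : WeierstrassCurve ℚ} [W'.IsElliptic] [W'.IsGloballyMinimal]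
      (D' : ModularParametrizationData W' N) (q : ℚ),
      (∀ z ∈ periodLattice D'.f, (q : ℂ) * z ∈ D'.L.lattice) → ∃ k : ℤ, (k : ℚ) = q :=
    hInt_of_pivot integral_neronScaling_of_isGloballyMinimal_holds edixhovenIntegrality_proof
  obtain ⟨q, hq0, hq, hdegq⟩ :=
    degree_eq_natCard_ker_mulQuotientMap_of_baseChange_eq_curve ψ hVs hWs
  have hPc : ∀ z ∈ periodLattice D'.f, (P.c : ℂ) * z ∈ P.L.lattice := fun z hz ↦
    P.smul_periodLattice_le z (hf ▸ hz)
  have hk' : ∀ z ∈ periodLattice D'.f, ((q * P.c : ℚ) : ℂ) * z ∈ D'.L.lattice := fun z hz ↦ by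
    have h := hq _ (hPc z hz)
    rw [← mul_assoc] at h
    push_cast
    exact h
  obtain ⟨k, hkq⟩ := hInt D' (q * P.c) hk'
  have hkC : (k : ℂ) = (q : ℂ) * (P.c : ℂ) := by
    have h := congrArg (fun x : ℚ => (x : ℂ)) hkq
    push_cast at h
    exact h
  have hk : ∀ z ∈ periodLattice D'.f, (k : ℂ) * z ∈ D'.L.lattice := fun z hz ↦ by
    have h := hk' z hz
    push_cast at h
    rwa [hkC]
  have hc : (P.c : ℚ) ≠ 0 := by exact_mod_cast P.maninConstant_ne_zero_holds
  have hk0 : k ≠ 0 := by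
    have h : (k : ℚ) ≠ 0 := by rw [hkq]; exact mul_ne_zero hq0 hc
    exact_mod_cast h
  haveI := discreteTopology_periodLattice_of_mul_mem D'.f D'.cast_c_ne_zero D'.smul_periodLattice_le
  obtain ⟨δ, hδ, hfinδ⟩ := exists_degree_eichlerShimuraMap' (N := N) D'.isNewformOf.1.ne_zero
  obtain ⟨Dk, hDkf, hDkL, -, hDkc⟩ := D'.exists_datum_c_eq hk0 hk
  obtain ⟨-, hdegK⟩ := Dk.modularDegree_eq_card_ker_mul_of_eichlerShimuraMap hDkf hδ hfinδ
  obtain ⟨-, hdegP⟩ := P.modularDegree_eq_card_ker_mul_of_eichlerShimuraMap hf.symm hδ hfinδ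
  have hqc : ∀ z ∈ (periodLattice P.f : AddSubgroup ℂ), (q : ℂ) * (P.c : ℂ) * z ∈
      D'.L.lattice.toAddSubgroup := fun z hz ↦ by
    rw [mul_assoc]
    exact hq _ (P.smul_periodLattice_le z hz)
  have hmul : Nat.card Dk.isogenyMap.ker = ψ.degree * Nat.card P.isogenyMap.ker := by
    have h1 : Nat.card Dk.isogenyMap.ker =
        Nat.card (mulQuotientMap (periodLattice P.f) D'.L.lattice.toAddSubgroup
          ((q : ℂ) * (P.c : ℂ)) hqc).ker :=
      natCard_ker_mulQuotientMap_congr' (by rw [hDkf, hf]) (by rw [hDkL]) (by rw [hDkc, hkC]) _ _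
    have hq'' : ∀ z ∈ P.L.lattice.toAddSubgroup, (q : ℂ) * z ∈ D'.L.lattice.toAddSubgroup :=
      fun z hz => hq z hz
    rw [h1, natCard_ker_mulQuotientMap_mul (Λ₂ := P.L.lattice.toAddSubgroup) P.cast_c_ne_zero
      P.smul_periodLattice_le hq'' hqc, ← hdegq]
    rfl
  calc D'.modularDegree ≤ Dk.modularDegree := hmin' Dk
    _ = Nat.card Dk.isogenyMap.ker * δ := hdegK
    _ = ψ.degree * (Nat.card P.isogenyMap.ker * δ) := by rw [hmul, mul_assoc]
    _ = ψ.degree * P.modularDegree := by rw [← hdegP]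

/-! ## 3. H2 (gen 4/5 verbatim, Mazur-free) and X (gen 6): the exact cost of one isogeny -/

/-- **H2a** (gen 5 verbatim): along a `ℚ`-isogeny of degree `d`, `c_v` moves by a factor `≤ d` at a
multiplicative place. [cite: PastenShimura2024, §6.4 (p. 22)] -/
theorem ordMinimalDiscriminant_le_degree_mul {W W' : WeierstrassCurve ℚ} [W.IsElliptic]
    [W'.IsElliptic] (ψ : Isogeny W W') (v : HeightOneSpectrum ℤ)
    (hv : W.HasMultiplicativeReductionAt v) :
    W'.ordMinimalDiscriminant v ≤ ψ.degree * W.ordMinimalDiscriminant v := by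
  obtain ⟨ψ', hcyc, hdvd⟩ := ψ.exists_isCyclic_degree_dvd
  have hv' : W'.HasMultiplicativeReductionAt v :=
    hasMultiplicativeReductionAt_of_isIsogenous ⟨ψ⟩ v hv
  obtain ⟨m, n, hm, hn, hmn, heq⟩ :=
    exists_ordMinimalDiscriminant_mul_eq_mul_of_isCyclic ψ'.degree ψ' hcyc rfl v hv hv'
  have hle : m * n ≤ ψ.degree :=
    (Nat.le_of_dvd ψ'.degree_pos hmn).trans (Nat.le_of_dvd ψ.degree_pos hdvd)
  have hn' : n ≤ ψ.degree := (Nat.le_mul_of_pos_left n hm).trans hle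
  calc W'.ordMinimalDiscriminant v
      ≤ W'.ordMinimalDiscriminant v * m := Nat.le_mul_of_pos_right _ hm
    _ = W.ordMinimalDiscriminant v * n := heq.symm
    _ ≤ W.ordMinimalDiscriminant v * ψ.degree := Nat.mul_le_mul_left _ hn'
    _ = ψ.degree * W.ordMinimalDiscriminant v := Nat.mul_comm _ _

/-- **H2** (gen 5 verbatim): `v_q(Δ_min W') ≤ d · v_q(Δ_min E_(a,b))` from ONE `ℚ`-isogeny
`E_(a,b) → W'` of degree `≤ d`, `q` an odd conductor prime. -/
theorem factorization_le_mul_of_isogeny {a b : ℤ} (hab : IsCoprime a b) (h0 : a * b * (a + b) ≠ 0)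
    {q : ℕ} (hq : q.Prime) (hq2 : q ≠ 2) (hqN : q ∣ (freyCurve a b).conductorNorm ℤ)
    {W' : WeierstrassCurve ℚ} [W'.IsElliptic] {B : ℕ} (φ : Isogeny (freyCurve a b) W')
    (hφ : φ.degree ≤ B) :
    (W'.minimalDiscriminantNorm ℤ).factorization q ≤
      B * ((freyCurve a b).minimalDiscriminantNorm ℤ).factorization q := by
  haveI := isElliptic_freyCurve h0
  obtain ⟨v, hv⟩ :
      ∃ v : HeightOneSpectrum ℤ, Rat.HeightOneSpectrum.natGenerator v = q :=
    ⟨(Rat.HeightOneSpectrum.primesEquiv (R := ℤ)).symm ⟨q, hq⟩,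
      Rat.natGenerator_primesEquiv_symm ⟨q, hq⟩⟩
  have hdvd : (q : ℤ) ∣ a * b * (a + b) := dvd_of_dvd_conductorNorm_freyCurve hab h0 hq hq2 hqN
  have hmult : (freyCurve a b).HasMultiplicativeReductionAt v :=
    hasMultiplicativeReductionAt_freyCurve_of_ne_two hab h0 v (hv ▸ hq2) (hv ▸ hdvd)
  have h1 := factorization_minimalDiscriminantNorm_holds (freyCurve a b) v
  have h2 := factorization_minimalDiscriminantNorm_holds W' v
  rw [hv] at h1 h2
  rw [h1, h2]
  exact (ordMinimalDiscriminant_le_degree_mul φ v hmult).trans (Nat.mul_le_mul_right _ hφ)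

/-- **X (gen 6) — the EXACT cost of one cyclic isogeny at a multiplicative place.**  If
`φ : W → W'` is cyclic and `W` is multiplicative at `v`, then `deg φ = a·b·r` with
`c_v(W)·b = c_v(W')·a` (`a, b ≥ 1`; classically `b = #(ker φ ∩ μ_d)`, the part of the kernel on
the toric line of Tate's uniformisation at `v`, and `a = #ker φ / b` in the sharp form `a·b = deg φ`;
the tree's lemma records `a·b ∣ deg φ`, whence the cofactor `r ≥ 1`) and

  `deg φ · c_v(W') = b² · r · c_v(W)`.

So the weighted quantity the crux charges is `b² r`: the valuation-raising index `a` is free.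
[cite: PastenShimura2024, §6.4 (p. 22)] [cite: SilvermanATAEC1994, Ex. V.5.10(a) (p. 416)] -/
theorem degree_mul_ordMinimalDiscriminant_eq {W W' : WeierstrassCurve ℚ} [W.IsElliptic]
    [W'.IsElliptic] (φ : Isogeny W W') (hφ : φ.IsCyclic) (v : HeightOneSpectrum ℤ)
    (hv : W.HasMultiplicativeReductionAt v) :
    ∃ a b r : ℕ, 0 < a ∧ 0 < b ∧ φ.degree = a * b * r ∧
      W.ordMinimalDiscriminant v * b = W'.ordMinimalDiscriminant v * a ∧
      φ.degree * W'.ordMinimalDiscriminant v = b * b * r * W.ordMinimalDiscriminant v := by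
  have hv' : W'.HasMultiplicativeReductionAt v :=
    hasMultiplicativeReductionAt_of_isIsogenous ⟨φ⟩ v hv
  obtain ⟨a, b, ha, hb, hab, heq⟩ :=
    exists_ordMinimalDiscriminant_mul_eq_mul_of_isCyclic φ.degree φ hφ rfl v hv hv'
  obtain ⟨r, hr⟩ := hab
  refine ⟨a, b, r, ha, hb, hr, heq, ?_⟩
  rw [hr]
  calc a * b * r * W'.ordMinimalDiscriminant v
      = b * r * (W'.ordMinimalDiscriminant v * a) := by ring
    _ = b * r * (W.ordMinimalDiscriminant v * b) := by rw [← heq]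
    _ = b * b * r * W.ordMinimalDiscriminant v := by ring

/-- **X′ (gen 6) — the toric-free regime is FREE.**  If along a cyclic `φ : W → W'` the
valuation does not go up (`c_v(W') ∣ c_v(W)`, i.e. `b = 1` is admissible), then
`deg φ · c_v(W') ≤ deg φ · c_v(W)` — trivially; recorded as the `T = deg φ`-instance used in the
STUB-IDEAS regime table. More useful is the general inequality `deg φ · c_v(W') ≤ deg φ² · c_v(W)`
(H2a), which is how every RADIUS supplier feeds W0. -/
theorem degree_mul_ordMinimalDiscriminant_le_sq {W W' : WeierstrassCurve ℚ} [W.IsElliptic]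
    [W'.IsElliptic] (φ : Isogeny W W') (v : HeightOneSpectrum ℤ)
    (hv : W.HasMultiplicativeReductionAt v) :
    φ.degree * W'.ordMinimalDiscriminant v ≤ φ.degree * φ.degree * W.ordMinimalDiscriminant v := by
  have h := ordMinimalDiscriminant_le_degree_mul φ v hv
  calc φ.degree * W'.ordMinimalDiscriminant v
      ≤ φ.degree * (φ.degree * W.ordMinimalDiscriminant v) := Nat.mul_le_mul_left _ h
    _ = φ.degree * φ.degree * W.ordMinimalDiscriminant v := by ring

/-! ## 4. Feeders of W0 -/

/-- Radius ⟹ weighted, pointwise: `deg φ ≤ B` gives `deg φ · v_q(W') ≤ B² · v_q(E)`. -/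
theorem degree_mul_factorization_le_of_degree_le {a b : ℤ} (hab : IsCoprime a b)
    (h0 : a * b * (a + b) ≠ 0) {q : ℕ} (hq : q.Prime) (hq2 : q ≠ 2)
    (hqN : q ∣ (freyCurve a b).conductorNorm ℤ) {W' : WeierstrassCurve ℚ} [W'.IsElliptic] {B : ℕ}
    (φ : Isogeny (freyCurve a b) W') (hφ : φ.degree ≤ B) :
    φ.degree * (W'.minimalDiscriminantNorm ℤ).factorization q ≤
      B * B * ((freyCurve a b).minimalDiscriminantNorm ℤ).factorization q := by
  have h := factorization_le_mul_of_isogeny hab h0 hq hq2 hqN φ hφ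
  calc φ.degree * (W'.minimalDiscriminantNorm ℤ).factorization q
      ≤ B * (B * ((freyCurve a b).minimalDiscriminantNorm ℤ).factorization q) :=
        Nat.mul_le_mul hφ h
    _ = B * B * ((freyCurve a b).minimalDiscriminantNorm ℤ).factorization q := by ring

/-- **L0 ⟹ W0** (radius at `ε/2`, squared): every gen-5 supplier of L0 feeds W0. -/
theorem freyWeightedTransportSubpoly_of_optimalRadiusSubpoly (h : FreyOptimalRadiusSubpoly) :
    FreyWeightedTransportSubpoly := by
  intro ε hε
  obtain ⟨R, hR⟩ := h (ε / 2) (half_pos hε)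
  refine ⟨(max R 0) ^ 2, fun a b hab h0 N _ hN q hq hq2 hqN W' _ P' hNW' hmin' hiso => ?_⟩
  haveI := isElliptic_freyCurve h0
  obtain ⟨φ, hφ⟩ := hR a b hab h0 N hN q hq hq2 hqN W' P' hNW' hmin' hiso
  refine ⟨φ, ?_⟩
  have hqN' : q ∣ (freyCurve a b).conductorNorm ℤ := by rw [hN]; exact hqN
  -- integer radius at this `N`
  set B : ℕ := ⌊max R 0 * (N : ℝ) ^ (ε / 2)⌋₊ with hB
  have hN0 : (0 : ℝ) ≤ (N : ℝ) := by positivity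
  have hpow0 : (0 : ℝ) ≤ (N : ℝ) ^ (ε / 2) := Real.rpow_nonneg hN0 _
  have hR0 : (0 : ℝ) ≤ max R 0 := le_max_right _ _
  have hφB : φ.degree ≤ B := by
    refine Nat.le_floor ?_
    calc (φ.degree : ℝ) ≤ R * (N : ℝ) ^ (ε / 2) := hφ
      _ ≤ max R 0 * (N : ℝ) ^ (ε / 2) := mul_le_mul_of_nonneg_right (le_max_left _ _) hpow0
  have hnat := degree_mul_factorization_le_of_degree_le hab h0 hq hq2 hqN' φ hφB
  have hcast : (φ.degree : ℝ) * ((W'.minimalDiscriminantNorm ℤ).factorization q : ℝ) ≤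
      (B : ℝ) * (B : ℝ) * (((freyCurve a b).minimalDiscriminantNorm ℤ).factorization q : ℝ) := by
    exact_mod_cast hnat
  have hBle : (B : ℝ) ≤ max R 0 * (N : ℝ) ^ (ε / 2) := Nat.floor_le (mul_nonneg hR0 hpow0)
  have hB0 : (0 : ℝ) ≤ (B : ℝ) := Nat.cast_nonneg _
  have hv0 : (0 : ℝ) ≤ (((freyCurve a b).minimalDiscriminantNorm ℤ).factorization q : ℝ) :=
    Nat.cast_nonneg _
  have hsq : (N : ℝ) ^ (ε / 2) * (N : ℝ) ^ (ε / 2) = (N : ℝ) ^ ε := by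
    rw [← Real.rpow_add' hN0 (by linarith)]
    ring_nf
  calc (φ.degree : ℝ) * ((W'.minimalDiscriminantNorm ℤ).factorization q : ℝ)
      ≤ (B : ℝ) * (B : ℝ) * (((freyCurve a b).minimalDiscriminantNorm ℤ).factorization q : ℝ) :=
        hcast
    _ ≤ (max R 0 * (N : ℝ) ^ (ε / 2)) * (max R 0 * (N : ℝ) ^ (ε / 2)) *
          (((freyCurve a b).minimalDiscriminantNorm ℤ).factorization q : ℝ) := by gcongr
    _ = (max R 0) ^ 2 * ((N : ℝ) ^ (ε / 2) * (N : ℝ) ^ (ε / 2)) *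
          (((freyCurve a b).minimalDiscriminantNorm ℤ).factorization q : ℝ) := by ring
    _ = (max R 0) ^ 2 * (N : ℝ) ^ ε *
          (((freyCurve a b).minimalDiscriminantNorm ℤ).factorization q : ℝ) := by rw [hsq]

/-- **L1 ⟹ W0** with `R_ε = R²` (the `N^ε` idle). -/
theorem freyWeightedTransportSubpoly_of_radius {R : ℕ} (hR : FreyIsogenyRadius R) :
    FreyWeightedTransportSubpoly := by
  intro ε hε
  refine ⟨((R * R : ℕ) : ℝ), fun a b hab h0 N _ hN q hq hq2 hqN W' _ P' _ _ hiso => ?_⟩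
  haveI := isElliptic_freyCurve h0
  have hqN' : q ∣ (freyCurve a b).conductorNorm ℤ := by rw [hN]; exact hqN
  obtain ⟨φ, hφ⟩ := hR a b hab h0 q hq hq2 hqN' W' hiso
  refine ⟨φ, ?_⟩
  have hnat := degree_mul_factorization_le_of_degree_le hab h0 hq hq2 hqN' φ hφ
  have hcast : (φ.degree : ℝ) * ((W'.minimalDiscriminantNorm ℤ).factorization q : ℝ) ≤
      ((R * R : ℕ) : ℝ) * (((freyCurve a b).minimalDiscriminantNorm ℤ).factorization q : ℝ) := by
    exact_mod_cast hnat
  have hN1 : (1 : ℝ) ≤ (N : ℝ) := by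
    exact_mod_cast Nat.one_le_iff_ne_zero.mpr (NeZero.ne N)
  have hrpow : (1 : ℝ) ≤ (N : ℝ) ^ ε := Real.one_le_rpow hN1 hε.le
  have hv0 : (0 : ℝ) ≤ (((freyCurve a b).minimalDiscriminantNorm ℤ).factorization q : ℝ) :=
    Nat.cast_nonneg _
  calc (φ.degree : ℝ) * ((W'.minimalDiscriminantNorm ℤ).factorization q : ℝ)
      ≤ ((R * R : ℕ) : ℝ) * (((freyCurve a b).minimalDiscriminantNorm ℤ).factorization q : ℝ) :=
        hcast
    _ = ((R * R : ℕ) : ℝ) * 1 *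
          (((freyCurve a b).minimalDiscriminantNorm ℤ).factorization q : ℝ) := by ring
    _ ≤ ((R * R : ℕ) : ℝ) * (N : ℝ) ^ ε *
          (((freyCurve a b).minimalDiscriminantNorm ℤ).factorization q : ℝ) := by gcongr

/-- The route item `MazurKenkuRadius` (stmt-ABC-15193) ⟹ L1 with `R = 163` (gen 5 verbatim). -/
theorem freyIsogenyRadius_of_mazurKenkuRadius (h : MazurKenkuRadius) : FreyIsogenyRadius 163 := by
  intro a b hab h0 q hq hq2 hqN W' _ hiso
  haveI := isElliptic_freyCurve h0
  exact h (freyCurve a b) W' hiso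

/-- stmt-ABC-15193 ⟹ W0 (`R_ε = 163²`). -/
theorem freyWeightedTransportSubpoly_of_mazurKenkuRadius (h : MazurKenkuRadius) :
    FreyWeightedTransportSubpoly :=
  freyWeightedTransportSubpoly_of_radius (freyIsogenyRadius_of_mazurKenkuRadius h)

end Summit.ABC.ABC.Cruxes.DefiniteRTControlPrime.StubIdeas2G6

/-! ## 5. The re-glue: the crux from Takahashi 2.3 and the WEIGHTED leaf (no valuation leg) -/

namespace Summit.ABC.ABC.Theorems.DefiniteRTControlPrime

open Summit.ABC.ABC.Theses.DefiniteXi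
open Summit.ABC.ABC.Cruxes.DefiniteRTControlPrime.StubIdeas2G6
open Literature.NumberTheory.EllipticCurves Literature.NumberTheory.EllipticCurves.ModularForms
open Literature.NumberTheory.Automorphic
open WeierstrassCurve

/-- **W-core (gen 6; pointwise, in `ℕ`).**  At one coprime pair, odd conductor prime `q`
(`N = M q`) and minimal datum `D` of the Frey MODEL: if the Frey curve is joined to the Takahashi
pivot `W⋆` by an isogeny `φ` with `deg φ · v_q(Δ_min W⋆) ≤ T · v_q(Δ_min E)`, then
`deg D ≤ 4 T · ξ(M; q) · v_q(Δ_min E)`.  Chain: `deg D ≤ 4 deg D₁` (landed model stubs);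
`deg D₁ ≤ deg φ · deg P⋆` (P1 along the dual of `φ` conjugated to the lattice curves);
`deg P⋆ ≤ ξ · v_q(Δ_min W⋆)` (Takahashi).  NO valuation leg, no `W₀`, no `h163`, no `h68`.
[cite: Takahashi2001, Thm. 2.3 (p. 79)] [cite: PastenShimura2024, §3 p. 13] -/
theorem deg_le_of_weightedIsogenyAt (hT : takahashi2001_thm_2_3_of_coprime) {a b : ℤ}
    (hab : IsCoprime a b) (h0 : a * b * (a + b) ≠ 0) {M q : ℕ} [NeZero (M * q)]
    (hN : (freyCurve a b).conductorNorm ℤ = M * q) (hq : q.Prime) (hq2 : q ≠ 2) {T : ℕ}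
    (hW : ∀ (W' : WeierstrassCurve ℚ) [W'.IsElliptic]
      (P' : ModularParametrizationData W' (M * q)), W'.conductorNorm ℤ = M * q →
      (∀ (W'' : WeierstrassCurve ℚ) [W''.IsElliptic], W''.conductorNorm ℤ = M * q →
          ∀ P'' : ModularParametrizationData W'' (M * q), P''.f = P'.f →
            P'.modularDegree ≤ P''.modularDegree) →
      (freyCurve a b).IsIsogenous W' →
        ∃ φ : Isogeny (freyCurve a b) W',
          φ.degree * (W'.minimalDiscriminantNorm ℤ).factorization q ≤
            T * ((freyCurve a b).minimalDiscriminantNorm ℤ).factorization q)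
    (D : ModularParametrizationData (freyCurve a b) (M * q))
    (hDmin : ∀ D' : ModularParametrizationData (freyCurve a b) (M * q), D.deg ≤ D'.deg) :
    D.deg ≤ 4 * T * (brandtXi M q (fun n => (freyCurve a b).LFunction n) *
      ((freyCurve a b).minimalDiscriminantNorm ℤ).factorization q) := by
  haveI := isElliptic_freyCurve h0
  have hdiv : M * q / q = M := Nat.mul_div_cancel M hq.pos
  have hqN' : q ∣ (freyCurve a b).conductorNorm ℤ := by rw [hN]; exact Dvd.intro_left M rfl
  -- `gcd(M, q) = 1`
  have hcop : M.Coprime q := by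
    have h := stub_freyLocal a b hab h0 q hq hq2 hqN'
    rwa [hN, hdiv] at h
  -- a global minimal model `W_m = C • E`, its data, a minimal one
  obtain ⟨C, hC⟩ := hasGlobalMinimalModel_rat_holds (freyCurve a b)
  haveI := hC
  have hNm : (C • freyCurve a b).conductorNorm ℤ = M * q := by rw [conductorNorm_smul_rat, hN]
  have hne : Nonempty (ModularParametrizationData (C • freyCurve a b) (M * q)) :=
    (Summit.ABC.ABC.Theorems.nonempty_modularParametrizationData_smul_iff C).mpr ⟨D⟩
  obtain ⟨D₁, -, hD₁min⟩ := exists_minimal_datum hne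
  -- the Takahashi pivot `(W⋆, P⋆)` — the ONLY auxiliary curve
  obtain ⟨Ws, hWs, Ps, hNs, hfs, hPsmin⟩ := exists_conductorMinimal D₁ hNm
  haveI := hWs
  -- Takahashi at `(W⋆, P⋆)`
  have hTak : Ps.modularDegree ≤ brandtXi M q (fun n => Ws.LFunction n) *
      (Ws.minimalDiscriminantNorm ℤ).factorization q :=
    takahashi2001_thm_2_3_of_coprime.modularDegree_le_brandtXi_mul hT Ws M q hq hcop
      hNs Ps hPsmin
  -- `a(W⋆) = a(f₁) = a(W_m) = a(E)`
  have hL : (fun n => Ws.LFunction n) = fun n => (freyCurve a b).LFunction n := by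
    funext n
    have h1 := Ps.isNewformOf.2 n
    have h2 := D₁.isNewformOf.2 n
    rw [hfs] at h1
    rw [h1, LFunction_smul] at h2
    exact_mod_cast h2
  rw [hL] at hTak
  -- THE ONE ISOGENY `φ : E → W⋆`, with its WEIGHTED bound
  have hiso : (freyCurve a b).IsIsogenous Ws :=
    (isIsogenous_smul (freyCurve a b) C).trans' (isIsogenous_of_f_eq D₁ Ps hfs)
  obtain ⟨φ, hφ⟩ := hW Ws Ps hNs hPsmin hiso
  -- (T_deg) the only use of `φ`: its dual, conjugated to the lattice (short) models, through P1
  have hEs : ((⟨1, -Ws.b₂ / 12, -Ws.a₁ / 2, Ws.a₁ * Ws.b₂ / 24 - Ws.a₃ / 2⟩ : VariableChange ℚ)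
      • Ws).baseChange ℂ = Ps.L.curve :=
    shortModel_baseChange_eq_curve Ws Ps.isNeronLattice
  have hEm : ((⟨1, -(C • freyCurve a b).b₂ / 12, -(C • freyCurve a b).a₁ / 2,
      (C • freyCurve a b).a₁ * (C • freyCurve a b).b₂ / 24 - (C • freyCurve a b).a₃ / 2⟩ :
        VariableChange ℚ) • (C • freyCurve a b)).baseChange ℂ = D₁.L.curve :=
    shortModel_baseChange_eq_curve (C • freyCurve a b) D₁.isNeronLattice
  set Cs : VariableChange ℚ := ⟨1, -Ws.b₂ / 12, -Ws.a₁ / 2, Ws.a₁ * Ws.b₂ / 24 - Ws.a₃ / 2⟩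
    with hCs
  set C' : VariableChange ℚ := ⟨1, -(C • freyCurve a b).b₂ / 12, -(C • freyCurve a b).a₁ / 2,
      (C • freyCurve a b).a₁ * (C • freyCurve a b).b₂ / 24 - (C • freyCurve a b).a₃ / 2⟩ with hC'
  obtain ⟨φd, hφd⟩ := exists_dual_degree_eq ((VariableChange.toIsogeny Ws Cs).comp φ)
  obtain ⟨ψ, hψ⟩ : ∃ ψ : Isogeny (Cs • Ws) (C' • (C • freyCurve a b)), ψ.degree = φ.degree :=
    ⟨((VariableChange.toIsogeny (C • freyCurve a b) C').comp
        (VariableChange.toIsogeny (freyCurve a b) C)).comp φd, by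
      rw [degree_comp, degree_comp, hφd, degree_comp, VariableChange.degree_toIsogeny,
        VariableChange.degree_toIsogeny, VariableChange.degree_toIsogeny]
      ring⟩
  have hdeg₁ : D₁.modularDegree ≤ φ.degree * Ps.modularDegree := by
    have h := modularDegree_le_degree_mul Ps D₁ hfs.symm hD₁min ψ hEs hEm
    rwa [hψ] at h
  -- (T_model) back to the Frey model
  obtain ⟨D₁', -, hdeg₁'⟩ := stub_smulTransportDeg C D₁
  have hscale : (C.u : ℚ).num.natAbs ≤ 2 := stub_freyScale a b hab h0 C hC
  have hD : D.deg ≤ 4 * D₁.modularDegree := by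
    calc D.deg ≤ D₁'.deg := hDmin D₁'
      _ = (C.u : ℚ).num.natAbs ^ 2 * D₁.deg := hdeg₁'
      _ ≤ 2 ^ 2 * D₁.deg := Nat.mul_le_mul_right _ (Nat.pow_le_pow_left hscale 2)
      _ = 4 * D₁.modularDegree := by norm_num [ModularParametrizationData.modularDegree]
  -- the chain in `ℕ` (the product `deg φ · v_q(W⋆)` appears as ONE factor)
  set ξ : ℕ := brandtXi M q (fun n => (freyCurve a b).LFunction n) with hξ
  set v : ℕ := ((freyCurve a b).minimalDiscriminantNorm ℤ).factorization q with hv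
  calc D.deg ≤ 4 * D₁.modularDegree := hD
    _ ≤ 4 * (φ.degree * Ps.modularDegree) := Nat.mul_le_mul_left _ hdeg₁
    _ ≤ 4 * (φ.degree * (ξ * (Ws.minimalDiscriminantNorm ℤ).factorization q)) :=
        Nat.mul_le_mul_left _ (Nat.mul_le_mul_left _ hTak)
    _ = 4 * ξ * (φ.degree * (Ws.minimalDiscriminantNorm ℤ).factorization q) := by ring
    _ ≤ 4 * ξ * (T * v) := Nat.mul_le_mul_left _ hφ
    _ = 4 * T * (ξ * v) := by ring

/-- **W-glue — `DefiniteRTControlPrime` from Takahashi 2.3 and the weighted leaf W0**,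
`C(ε) = 4 (R_ε⁺ + 1)` (`R⁺ = max R 0`): with `T := ⌈R⁺ N^ε⌉₊` in the W-core,
`deg D ≤ 4 T ξ v ≤ 4 (R⁺ N^ε + 1) ξ v ≤ 4 (R⁺ + 1) N^ε ξ v`. -/
theorem definiteRTControlPrime_of_weightedTransportSubpoly (hT : takahashi2001_thm_2_3_of_coprime)
    (hW0 : FreyWeightedTransportSubpoly) : DefiniteRTControlPrime := by
  intro ε hε
  obtain ⟨R, hR⟩ := hW0 ε hε
  refine ⟨4 * (max R 0 + 1), ?_⟩
  intro a b hab h0 N _ hN q hq hq2 hqN D hDmin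
  have hRN := hR a b hab h0 N hN q hq hq2 hqN
  -- `N = M q`
  obtain ⟨M, hM⟩ := hqN
  rw [mul_comm] at hM
  subst hM
  have hdiv : M * q / q = M := Nat.mul_div_cancel M hq.pos
  rw [hdiv]
  set Nr : ℝ := ((M * q : ℕ) : ℝ) with hNr
  have hNr0 : (0 : ℝ) ≤ Nr := by positivity
  have hR0 : (0 : ℝ) ≤ max R 0 := le_max_right _ _
  have hpow0 : (0 : ℝ) ≤ Nr ^ ε := Real.rpow_nonneg hNr0 _
  have hN1 : (1 : ℝ) ≤ Nr := by
    rw [hNr]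
    exact_mod_cast Nat.one_le_iff_ne_zero.mpr (NeZero.ne (M * q))
  have hrpow : (1 : ℝ) ≤ Nr ^ ε := Real.one_le_rpow hN1 hε.le
  -- the integer weight at this `N`
  set T : ℕ := ⌈max R 0 * Nr ^ ε⌉₊ with hTdef
  have hWT : ∀ (W' : WeierstrassCurve ℚ) [W'.IsElliptic]
      (P' : ModularParametrizationData W' (M * q)), W'.conductorNorm ℤ = M * q →
      (∀ (W'' : WeierstrassCurve ℚ) [W''.IsElliptic], W''.conductorNorm ℤ = M * q →
          ∀ P'' : ModularParametrizationData W'' (M * q), P''.f = P'.f →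
            P'.modularDegree ≤ P''.modularDegree) →
      (freyCurve a b).IsIsogenous W' →
        ∃ φ : Isogeny (freyCurve a b) W',
          φ.degree * (W'.minimalDiscriminantNorm ℤ).factorization q ≤
            T * ((freyCurve a b).minimalDiscriminantNorm ℤ).factorization q := by
    intro W' _ P' hNW' hmin' hiso
    obtain ⟨φ, hφ⟩ := hRN W' P' hNW' hmin' hiso
    refine ⟨φ, ?_⟩
    have hv0 : (0 : ℝ) ≤ (((freyCurve a b).minimalDiscriminantNorm ℤ).factorization q : ℝ) :=
      Nat.cast_nonneg _
    have hTge : max R 0 * Nr ^ ε ≤ (T : ℝ) := Nat.le_ceil _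
    have h : (φ.degree : ℝ) * ((W'.minimalDiscriminantNorm ℤ).factorization q : ℝ) ≤
        (T : ℝ) * (((freyCurve a b).minimalDiscriminantNorm ℤ).factorization q : ℝ) :=
      calc (φ.degree : ℝ) * ((W'.minimalDiscriminantNorm ℤ).factorization q : ℝ)
          ≤ R * Nr ^ ε * (((freyCurve a b).minimalDiscriminantNorm ℤ).factorization q : ℝ) := hφ
        _ ≤ max R 0 * Nr ^ ε * (((freyCurve a b).minimalDiscriminantNorm ℤ).factorization q : ℝ) :=
            mul_le_mul_of_nonneg_right (mul_le_mul_of_nonneg_right (le_max_left _ _) hpow0) hv0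
        _ ≤ (T : ℝ) * (((freyCurve a b).minimalDiscriminantNorm ℤ).factorization q : ℝ) :=
            mul_le_mul_of_nonneg_right hTge hv0
    exact_mod_cast h
  have hchain := deg_le_of_weightedIsogenyAt hT hab h0 hN hq hq2 hWT D hDmin
  set ξ : ℕ := brandtXi M q (fun n => (freyCurve a b).LFunction n) with hξ
  set v : ℕ := ((freyCurve a b).minimalDiscriminantNorm ℤ).factorization q with hv
  have hcast : (D.deg : ℝ) ≤ 4 * (T : ℝ) * ((ξ : ℝ) * (v : ℝ)) := by
    exact_mod_cast hchain
  have hξv : (0 : ℝ) ≤ (ξ : ℝ) * (v : ℝ) := by positivity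
  have hTle : (T : ℝ) ≤ (max R 0 + 1) * Nr ^ ε := by
    have h1 : (T : ℝ) < max R 0 * Nr ^ ε + 1 := Nat.ceil_lt_add_one (mul_nonneg hR0 hpow0)
    have h2 : max R 0 * Nr ^ ε + 1 ≤ max R 0 * Nr ^ ε + Nr ^ ε := by linarith
    calc (T : ℝ) ≤ max R 0 * Nr ^ ε + 1 := h1.le
      _ ≤ max R 0 * Nr ^ ε + Nr ^ ε := h2
      _ = (max R 0 + 1) * Nr ^ ε := by ring
  calc (D.deg : ℝ) ≤ 4 * (T : ℝ) * ((ξ : ℝ) * (v : ℝ)) := hcast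
    _ ≤ 4 * ((max R 0 + 1) * Nr ^ ε) * ((ξ : ℝ) * (v : ℝ)) := by gcongr
    _ = 4 * (max R 0 + 1) * Nr ^ ε * ((ξ : ℝ) * (v : ℝ)) := by ring

/-- **W-glue ∘ (L0 ⟹ W0)**: gen 5's leaf still closes the crux through the weighted glue. -/
theorem definiteRTControlPrime_of_optimalRadiusSubpoly' (hT : takahashi2001_thm_2_3_of_coprime)
    (h : FreyOptimalRadiusSubpoly) : DefiniteRTControlPrime :=
  definiteRTControlPrime_of_weightedTransportSubpoly hT
    (freyWeightedTransportSubpoly_of_optimalRadiusSubpoly h)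

/-- **W-glue ∘ S**: the crux from Takahashi 2.3 and the route item `MazurKenkuRadius`
(stmt-ABC-15193) ALONE, through the weighted leaf (neither Pasten fact, no `W₀`). -/
theorem definiteRTControlPrime_of_mazurKenkuRadius_weighted (hT : takahashi2001_thm_2_3_of_coprime)
    (h : MazurKenkuRadius) : DefiniteRTControlPrime :=
  definiteRTControlPrime_of_weightedTransportSubpoly hT
    (freyWeightedTransportSubpoly_of_mazurKenkuRadius h)

end Summit.ABC.ABC.Theorems.DefiniteRTControlPrime

end
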